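import Literature.Barriers.CriticalPhenomena.LaceExpansionXSpaceTwoLongLinesConfigs
import Literature.Barriers.CriticalPhenomena.LaceExpansionXSpaceLemma15Diagrams
import HarnessLib

/-!
# The stages of the Hara–Slade diagram for the two-long-lines insertion: readers of the two
# strands, marked variants with their weights `b`, `2dp_c b`, and their validity — PROVED

Barrier catalogue `Literature/Barriers/CriticalPhenomena/` (D-0021), infrastructure for the
conditional reduction of `Hara2008_twoLongLinesDiagramBoundPc` (`LaceExpansionXSpaceLemma15Diagrams.lean`,
Hara 2008, §3.5), continuing `LaceExpansionXSpaceTwoLongLinesConfigs.lean`.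

The generic two-strand insertion of `LaceExpansionXSpaceLongLineInsertion.lean` is fed with the
`2n+1` fine stages `B₁, B₂, …, B₁` of the diagram bounding `Π^{(n+1)}_{p_c}` (Heydenreich–van der
Hofstad (7.4.10)): strand 1 starts on the first coordinate and the strands "interchange
coordinates after every `B₂`" (§7.5.2), so at the fine stage `j` strand 1 sits on coordinate 1 iff
`⌊j/2⌋` is even (`cAt j`). Each stage carries one line of each strand; a line of displacement at least
`r = |x|/(2N+1)` is bounded by `b` (a `τ`-line; the hypothesis of `Hara2008_twoLongLinesDiagramBoundPc`
dominates `G` beyond `|x|/(2N+1) - 1`) or by `2dp_c b` (a pivotal line, `tauTildePc_le_of_far`),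
and the marked variants are the erased kernels of `LaceExpansionXSpaceTwoLongLinesConfigs.lean` times
these weights. PROVED here:

* the bookkeeping `cAt`, the positive distance of a nonzero site, the weights `β₁ = b`, `β₂ = 2dp_c b`
  (both `≤ 2d·b`) and the bound on a long `τ`- / `τ̃`-line;
* the variants `b1Var`, `b1Both`, `b2Var`, `stVar`, `b2Vars`, `b2Both`, `varsAt`, `bothAt`, the
  stages `stageAt`, `stagesL` and their kernels (`= altL true (2n+1)`), counts and last readers;
* VALIDITY of every stage (`stageAt_valid`: a long strand line makes the kernel at most the sum of
  its marked variants), of the start vector (`start_inv`) and of the end vector (`end_le_*`);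
* the decompositions of the fine list with one or two kernels replaced (`altL_set_*`) and the
  positions of the variants (`stagesL_get`).

## References

* T. Hara, Ann. Probab. 36 (2008) 530–593 (arXiv:math-ph/0504021): §3.5 ("We have a segment of
  length `≥ |x|/(2N+1)` on the upper and lower sides"), §3.4 (the line `2dp(D ⋆ G)`).
* M. Heydenreich, R. van der Hofstad, *Progress in High-Dimensional Percolation and Random
  Graphs*, Springer 2017: (7.4.3)–(7.4.4), (7.4.10), §7.5.2 (interchange of the coordinates).
-/

noncomputable section

open scoped ENNReal

namespace Literature.Barriers.CriticalPhenomena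

open _root_.MeasureTheory Literature.Probability.LatticeModels Literature.Probability.Percolation

variable {d : ℕ}

/-! ### Parities -/

/-- `bodd (2i) = false`. [folklore] -/
theorem bodd_two_mul (i : ℕ) : Nat.bodd (2 * i) = false := by
  rw [Nat.bodd_mul]; rfl

/-- `bodd (2i+1) = true`. [folklore] -/
theorem bodd_two_mul_add_one (i : ℕ) : Nat.bodd (2 * i + 1) = true := by
  rw [Nat.bodd_add, bodd_two_mul]; rfl

/-- **Strand 1 sits on coordinate 1 at the input of fine stage `j` iff `⌊j/2⌋` is even** (the strands
interchange after every `B₂`, i.e. after every odd stage). [cite: HeydenreichVanDerHofstad2017, §7.5.2] -/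
def cAt (j : ℕ) : Bool := !Nat.bodd (j / 2)

/-- `cAt (2i) = ¬ odd i`. [folklore] -/
theorem cAt_two_mul (i : ℕ) : cAt (2 * i) = !Nat.bodd i := by
  rw [cAt, Nat.mul_div_cancel_left i two_pos]

/-- `cAt (2i+1) = cAt (2i)` (no interchange inside `B₁`). [folklore] -/
theorem cAt_two_mul_add_one (i : ℕ) : cAt (2 * i + 1) = !Nat.bodd i := by
  rw [cAt, show (2 * i + 1) / 2 = i by omega]

/-- `cAt 0 = true`. [folklore] -/
@[simp] theorem cAt_zero : cAt 0 = true := rfl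

/-- After an even (a `B₁`) stage the coordinate is unchanged. [folklore] -/
theorem cAt_succ_two_mul (i : ℕ) : cAt (2 * i + 1) = cAt (2 * i) := by
  rw [cAt_two_mul, cAt_two_mul_add_one]

/-- After an odd (a `B₂`) stage the coordinate is interchanged. [cite: HeydenreichVanDerHofstad2017, §7.5.2] -/
theorem cAt_succ_two_mul_add_one (i : ℕ) : cAt (2 * i + 1 + 1) = !cAt (2 * i + 1) := by
  rw [cAt_two_mul_add_one, show 2 * i + 1 + 1 = 2 * (i + 1) by ring, cAt_two_mul, Nat.bodd_succ]

/-- `cAt (2(i+k)+·)` relative to `cAt (2i+·)`: `k` interchanges. [folklore] -/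
theorem xor_cAt_two_mul (i k : ℕ) : xor (cAt (2 * i)) (cAt (2 * (i + k))) = Nat.bodd k := by
  rw [cAt_two_mul, cAt_two_mul, Nat.bodd_add]
  cases Nat.bodd i <;> cases Nat.bodd k <;> rfl

/-! ### The distance scale and the weights of the long lines -/

/-- The scale `r = |x|/(2n+3)` of Hara's pigeonhole is positive for `x ≠ 0` (a nonzero site has
Euclidean norm `≥ 1`: `one_le_norm_of_ne_zero`, `norm_le_euclidNorm`). [cite: Hara2008, §3.5] -/
theorem scale_pos {x : Site d} (hx : x ≠ 0) (n : ℕ) : 0 < euclidNorm x / (2 * (n : ℝ) + 3) :=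
  div_pos (lt_of_lt_of_le zero_lt_one ((one_le_norm_of_ne_zero hx).trans (norm_le_euclidNorm x))) (by positivity)

section Weights

variable (d) (b : ℝ)

/-- The weight of an erased `τ`-line: `β₁ = b`. [cite: Hara2008, §3.5 (G_{x,N})] -/
def wβ₁ : ℝ≥0∞ := ENNReal.ofReal b

/-- The weight of an erased pivotal line: `β₂ = 2dp_c b`. [cite: Hara2008, §3.4 (2dp(D ⋆ G))] -/
def wβ₂ : ℝ≥0∞ := ENNReal.ofReal (2 * d * (criticalProbI d : ℝ) * b)

/-- The common bound `β = 2d·b⁺` of the two weights. [folklore] -/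
def wβ : ℝ≥0∞ := 2 * d * ENNReal.ofReal b

variable {d b}

/-- `β₁ ≤ β` (`d ≥ 1`). [folklore] -/
theorem wβ₁_le (hd : 1 ≤ d) : wβ₁ b ≤ wβ d b := by
  show ENNReal.ofReal b ≤ 2 * d * ENNReal.ofReal b
  exact le_mul_of_one_le_left' (one_le_two_mul_d hd)

/-- `β₂ ≤ β` (`p_c ≤ 1`). [folklore] -/
theorem wβ₂_le : wβ₂ d b ≤ wβ d b := by
  rw [wβ₂, wβ]
  have hp0 : 0 ≤ (criticalProbI d : ℝ) := (criticalProbI d).2.1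
  have hA : 0 ≤ 2 * (d : ℝ) := by positivity
  rcases le_or_gt 0 b with hb | hb
  · have hp1 : (criticalProbI d : ℝ) ≤ 1 := (criticalProbI d).2.2
    calc ENNReal.ofReal (2 * d * (criticalProbI d : ℝ) * b) ≤ ENNReal.ofReal (2 * d * b) :=
          ENNReal.ofReal_le_ofReal (mul_le_mul_of_nonneg_right (mul_le_of_le_one_right hA hp1) hb)
      _ = 2 * d * ENNReal.ofReal b := by
          rw [ENNReal.ofReal_mul hA, ENNReal.ofReal_mul zero_le_two, ENNReal.ofReal_ofNat, ENNReal.ofReal_natCast]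
  · have hle : 2 * (d : ℝ) * (criticalProbI d : ℝ) * b ≤ 0 := by
      calc 2 * (d : ℝ) * (criticalProbI d : ℝ) * b ≤ 2 * (d : ℝ) * (criticalProbI d : ℝ) * 0 :=
            mul_le_mul_of_nonneg_left hb.le (mul_nonneg hA hp0)
        _ = 0 := mul_zero _
    rw [ENNReal.ofReal_of_nonpos hle]
    exact zero_le

/-- The weight selected by the coordinate of the erased line of `B₁`: `b` for `τ`, `2dp_c b` for `τ̃`. [folklore] -/
def wβc (d : ℕ) (b : ℝ) (c : Bool) : ℝ≥0∞ := if c then wβ₁ b else wβ₂ d b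

/-- `wβc c ≤ β`. [folklore] -/
theorem wβc_le (hd : 1 ≤ d) (c : Bool) : wβc d b c ≤ wβ d b := by
  cases c
  · exact wβ₂_le
  · exact wβ₁_le hd

end Weights

section Far

variable {x : Site d} {b : ℝ} {n : ℕ}

/-- The hypothesis of `Hara2008_twoLongLinesDiagramBoundPc` in terms of the scale `r`: `b` dominates
`G` on `|y| ≥ r - 1`. [cite: Hara2008, §3.5] -/
theorem far_hyp (hb : ∀ y : Site d, euclidNorm x / (2 * (((n + 1 : ℕ)) : ℝ) + 1) - 1 ≤ euclidNorm y →
      tau d (criticalProbI d) 0 y ≤ b) (y : Site d) (hy : euclidNorm x / (2 * (n : ℝ) + 3) - 1 ≤ euclidNorm y) :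
    tau d (criticalProbI d) 0 y ≤ b := by
  refine hb y ?_
  have h : (2 * (((n + 1 : ℕ)) : ℝ) + 1) = 2 * (n : ℝ) + 3 := by push_cast; ring
  rwa [h]

/-- **A long `τ`-line is at most `b`.** [cite: Hara2008, §3.5 ("extracting two factors of G_{x,N}")] -/
theorem tauPcE_le_wβ₁_of_far (hb : ∀ y : Site d, euclidNorm x / (2 * (((n + 1 : ℕ)) : ℝ) + 1) - 1 ≤ euclidNorm y →
      tau d (criticalProbI d) 0 y ≤ b) {v : Site d} (hv : euclidNorm x / (2 * (n : ℝ) + 3) ≤ euclidNorm v) :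
    tauPcE d v ≤ wβ₁ b :=
  ENNReal.ofReal_le_ofReal (far_hyp hb v (by linarith))

/-- **A long pivotal line is at most `2dp_c b`.** [cite: Hara2008, §3.4 (2dp(D ⋆ G) "almost the same as G")] -/
theorem tauTildePcE_le_wβ₂_of_far (hb : ∀ y : Site d, euclidNorm x / (2 * (((n + 1 : ℕ)) : ℝ) + 1) - 1 ≤ euclidNorm y →
      tau d (criticalProbI d) 0 y ≤ b) {v : Site d} (hv : euclidNorm x / (2 * (n : ℝ) + 3) ≤ euclidNorm v) :
    tauTildePcE d v ≤ wβ₂ d b := by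
  refine ENNReal.ofReal_le_ofReal (tauTildePc_le_of_far (r := euclidNorm x / (2 * (n : ℝ) + 3)) ?_ (far_hyp hb))
  rwa [sub_zero]

/-- A long line of `B₁` on coordinate `c` is at most its weight. [cite: Hara2008, §3.5] -/
theorem lineF_le_wβc_of_far (hb : ∀ y : Site d, euclidNorm x / (2 * (((n + 1 : ℕ)) : ℝ) + 1) - 1 ≤ euclidNorm y →
      tau d (criticalProbI d) 0 y ≤ b) (c : Bool) {v : Site d} (hv : euclidNorm x / (2 * (n : ℝ) + 3) ≤ euclidNorm v) :
    lineF d c v ≤ wβc d b c := by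
  cases c
  · exact tauTildePcE_le_wβ₂_of_far hb hv
  · exact tauPcE_le_wβ₁_of_far hb hv

end Far

/-! ### The marked variants and the stages -/

section Stages

variable (d) (b : ℝ)

/-- `B₁(2i)` with the line of the strand on coordinate `c` erased, weighted. [cite: Hara2008, §3.5] -/
def b1Var (c : Bool) : Site d × Site d → Site d × Site d → ℝ≥0∞ := fun p q => wβc d b c * b1Er d c p q

/-- `B₁` with both lines erased. [cite: Hara2008, §3.5] -/
def b1Both : Site d × Site d → Site d × Site d → ℝ≥0∞ := fun p q => wβ₁ b * wβ₂ d b * kProp (oneF d) (oneF d) p q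

/-- `B₂⁽¹⁾` with the crossed line out of coordinate `c` erased, weighted. [cite: Hara2008, §3.5] -/
def b2Var (c : Bool) : Site d × Site d → Site d × Site d → ℝ≥0∞ :=
  fun p q => wβ₁ b * kRungL (kRungR (b2oneCore d c)) p q

/-- `B₂⁽²⁾` with its line `u → t` erased, weighted. [cite: Hara2008, §3.5] -/
def stVar : Site d × Site d → Site d × Site d → ℝ≥0∞ := fun p q => wβ₁ b * kB2twoEr d p q

/-- The variants of `B₂` for the strand ENTERING on coordinate `c`: on coordinate 1 its line `u → t`
lies in both terms of `B₂`, on coordinate 2 its line `v → s` lies in `B₂⁽¹⁾` only (in `B₂⁽²⁾` it has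
displacement `0`). [cite: HeydenreichVanDerHofstad2017, (7.4.4) and §7.5.2] -/
def b2Vars (c : Bool) : List (Site d × Site d → Site d × Site d → ℝ≥0∞) :=
  if c then [b2Var d b true, stVar d b] else [b2Var d b false]

/-- `B₂⁽¹⁾` with both crossed lines erased (two rungs and a constant). [cite: Hara2008, §3.5] -/
def b2Both : Site d × Site d → Site d × Site d → ℝ≥0∞ :=
  fun p q => wβ₁ b ^ 2 * kRungL (kRungR (kPropX (oneF d) (oneF d))) p q

/-- The variants at fine stage `j` for the strand on (entering on) coordinate `c`. [cite: Hara2008, §3.5] -/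
def varsAt (j : ℕ) (c : Bool) : List (Site d × Site d → Site d × Site d → ℝ≥0∞) :=
  if Nat.bodd j then b2Vars d b c else [b1Var d b c]

/-- The doubly erased kernel at fine stage `j`. [cite: Hara2008, §3.5] -/
def bothAt (j : ℕ) : Site d × Site d → Site d × Site d → ℝ≥0∞ := if Nat.bodd j then b2Both d b else b1Both d b

/-- **The fine stage `j` of the diagram** with its readers and variants. [cite: Hara2008, §3.5] -/
def stageAt (j : ℕ) : MStage (Site d) where
  K := if Nat.bodd j then kB2 d else kB1 d
  φ₁ := crd (cAt (j + 1))
  φ₂ := crd (!cAt (j + 1))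
  c₁ := 1
  c₂ := 1
  K1 := varsAt d b j (cAt j)
  K2 := varsAt d b j (!cAt j)
  K12 := [bothAt d b j]

/-- The stages `k, k+1, …, k+m-1`. [cite: HeydenreichVanDerHofstad2017, (7.4.10)] -/
def stagesFrom (k m : ℕ) : List (MStage (Site d)) := (List.range' k m).map (stageAt d b)

/-- **The `2n+1` fine stages of the diagram of `Π^{(n+1)}`.** [cite: HeydenreichVanDerHofstad2017, (7.4.10)] -/
def stagesL (n : ℕ) : List (MStage (Site d)) := stagesFrom d b 0 (2 * n + 1)

variable {d b}

/-- The kernel of stage `j`. [folklore] -/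
theorem stageAt_K (j : ℕ) : (stageAt d b j).K = if Nat.bodd j then kB2 d else kB1 d := rfl

/-- Stage `j` has one line of strand 1. [folklore] -/
@[simp] theorem stageAt_c₁ (j : ℕ) : (stageAt d b j).c₁ = 1 := rfl

/-- Stage `j` has one line of strand 2. [folklore] -/
@[simp] theorem stageAt_c₂ (j : ℕ) : (stageAt d b j).c₂ = 1 := rfl

/-- Unfolding of `stagesFrom` on `m + 1`. [folklore] -/
theorem stagesFrom_succ (k m : ℕ) : stagesFrom d b k (m + 1) = stageAt d b k :: stagesFrom d b (k + 1) m := by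
  rw [stagesFrom, List.range'_succ, List.map_cons]; rfl

/-- `stagesFrom k 0 = []`. [folklore] -/
@[simp] theorem stagesFrom_zero (k : ℕ) : stagesFrom d b k 0 = [] := rfl

/-- The alternating list with one more kernel at the end. [folklore] -/
theorem altL_succ_snoc (c : Bool) (m : ℕ) :
    altL d c (m + 1) = altL d c m ++ [if xor c (Nat.bodd m) then kB1 d else kB2 d] := by
  rw [altL_add c m 1, altL_succ]; rfl

/-- **The kernels of the stages from `k` are the alternating list** starting with `B₁` iff `k` is even. [folklore] -/
theorem kernels_stagesFrom (k m : ℕ) : kernels (stagesFrom d b k m) = altL d (!Nat.bodd k) m := by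
  induction m generalizing k with
  | zero => simp
  | succ m ih =>
    rw [stagesFrom_succ, kernels_cons, ih (k + 1), altL_succ, stageAt_K, Nat.bodd_succ]
    cases Nat.bodd k <;> rfl

/-- **The kernels of the stages are the fine list `B₁, B₂, …, B₁`.** [cite: HeydenreichVanDerHofstad2017, (7.4.10)] -/
theorem kernels_stagesL (n : ℕ) : kernels (stagesL d b n) = altL d true (2 * n + 1) :=
  kernels_stagesFrom 0 (2 * n + 1)

/-- `|stagesFrom k m| = m`. [folklore] -/
@[simp] theorem length_stagesFrom (k m : ℕ) : (stagesFrom d b k m).length = m := by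
  simp [stagesFrom]

/-- `|stagesL n| = 2n+1`. [folklore] -/
@[simp] theorem length_stagesL (n : ℕ) : (stagesL d b n).length = 2 * n + 1 := length_stagesFrom 0 _

/-- Every stage carries one line of strand 1. [folklore] -/
theorem count₁_stagesFrom (k m : ℕ) : count₁ (stagesFrom d b k m) = m := by
  induction m generalizing k with
  | zero => rfl
  | succ m ih => rw [stagesFrom_succ, count₁, ih, add_comm]; rfl

/-- Every stage carries one line of strand 2. [folklore] -/
theorem count₂_stagesFrom (k m : ℕ) : count₂ (stagesFrom d b k m) = m := by
  induction m generalizing k with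
  | zero => rfl
  | succ m ih => rw [stagesFrom_succ, count₂, ih, add_comm]; rfl

/-- The readers after the stages from `k`: the coordinates at stage `k + m`. [folklore] -/
theorem lastReaders_stagesFrom (k m : ℕ) (ψ₁ ψ₂ : Site d × Site d → Site d) :
    lastReaders ψ₁ ψ₂ (stagesFrom d b k (m + 1)) = (crd (cAt (k + m + 1)), crd (!cAt (k + m + 1))) := by
  induction m generalizing k ψ₁ ψ₂ with
  | zero => rfl
  | succ m ih =>
    rw [stagesFrom_succ, lastReaders, ih, show k + 1 + m + 1 = k + (m + 1) + 1 by ring]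

/-- **The readers at the end: strand 1 on `crd (cAt (2n+1))`, strand 2 on the other coordinate.** [folklore] -/
theorem lastReaders_stagesL (n : ℕ) :
    lastReaders (crd true) (crd false) (stagesL d b n) = (crd (cAt (2 * n + 1)), crd (!cAt (2 * n + 1))) := by
  rw [stagesL, lastReaders_stagesFrom]
  simp

/-- **The stage at position `j` of the list is `stageAt j`.** [folklore] -/
theorem stagesL_get (n j : ℕ) (hj : j < (stagesL d b n).length) : (stagesL d b n).get ⟨j, hj⟩ = stageAt d b j := by
  rw [List.get_eq_getElem]
  simp [stagesL, stagesFrom]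

/-- The variants at an even stage. [folklore] -/
theorem mem_varsAt_even {i : ℕ} {c : Bool} {M : Site d × Site d → Site d × Site d → ℝ≥0∞}
    (hM : M ∈ varsAt d b (2 * i) c) : M = b1Var d b c := by
  simpa [varsAt, bodd_two_mul] using hM

/-- The variants at an odd stage. [folklore] -/
theorem mem_varsAt_odd {i : ℕ} {c : Bool} {M : Site d × Site d → Site d × Site d → ℝ≥0∞}
    (hM : M ∈ varsAt d b (2 * i + 1) c) : M = b2Var d b c ∨ (c = true ∧ M = stVar d b) := by
  cases c
  · left; simpa [varsAt, bodd_two_mul_add_one, b2Vars] using hM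
  · simp only [varsAt, bodd_two_mul_add_one, b2Vars, if_true, List.mem_cons, List.not_mem_nil, or_false] at hM
    rcases hM with h | h
    · exact Or.inl h
    · exact Or.inr ⟨rfl, h⟩

/-- The doubly erased kernel at an even stage. [folklore] -/
theorem bothAt_even (i : ℕ) : bothAt d b (2 * i) = b1Both d b := by simp [bothAt]

/-- The doubly erased kernel at an odd stage. [folklore] -/
theorem bothAt_odd (i : ℕ) : bothAt d b (2 * i + 1) = b2Both d b := by simp [bothAt]

/-- Every stage has at most two variants of each kind. [cite: Hara2008, §3.5 ("(2N+1)² choices")] -/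
theorem stageAt_lengths (j : ℕ) :
    (stageAt d b j).K1.length ≤ 2 ∧ (stageAt d b j).K2.length ≤ 2 ∧ (stageAt d b j).K12.length ≤ 2 := by
  refine ⟨?_, ?_, by simp [stageAt]⟩ <;>
  · simp only [stageAt, varsAt, b2Vars]
    split_ifs <;> simp

end Stages

/-! ### Validity of the stages, of the start and of the end -/

section Valid

variable {x : Site d} {b : ℝ} {n : ℕ}
variable (hb : ∀ y : Site d, euclidNorm x / (2 * (((n + 1 : ℕ)) : ℝ) + 1) - 1 ≤ euclidNorm y →
  tau d (criticalProbI d) 0 y ≤ b)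
include hb

/-- **A long line of `B₁` on coordinate `c`**: `B₁ ≤` (weight) `·` (`B₁` with that line erased). [cite: Hara2008, §3.5] -/
theorem kB1_le_b1Var (c : Bool) {p q : Site d × Site d}
    (h : euclidNorm x / (2 * (n : ℝ) + 3) ≤ euclidNorm (crd c q - crd c p)) : kB1 d p q ≤ b1Var d b c p q := by
  cases c
  · -- the pivotal line on coordinate 2 is long
    calc kB1 d p q = tauPcE d (q.1 - p.1) * tauTildePcE d (q.2 - p.2) := by rw [kB1_eq_kProp, kProp]
      _ ≤ tauPcE d (q.1 - p.1) * wβ₂ d b := mul_le_mul' le_rfl (tauTildePcE_le_wβ₂_of_far hb h)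
      _ = b1Var d b false p q := by simp only [b1Var, wβc, b1Er, kProp, oneF_apply, Bool.false_eq_true, if_false]; ring
  · -- the `τ`-line on coordinate 1 is long
    calc kB1 d p q = tauPcE d (q.1 - p.1) * tauTildePcE d (q.2 - p.2) := by rw [kB1_eq_kProp, kProp]
      _ ≤ wβ₁ b * tauTildePcE d (q.2 - p.2) := mul_le_mul' (tauPcE_le_wβ₁_of_far hb h) le_rfl
      _ = b1Var d b true p q := by simp only [b1Var, wβc, b1Er, kProp, oneF_apply, if_true]; ring

/-- A long line on `c` upgrades the variant erased on `!c` to the doubly erased `B₁`. [cite: Hara2008, §3.5] -/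
theorem b1Var_not_le_b1Both (c : Bool) {p q : Site d × Site d}
    (h : euclidNorm x / (2 * (n : ℝ) + 3) ≤ euclidNorm (crd c q - crd c p)) : b1Var d b (!c) p q ≤ b1Both d b p q := by
  cases c
  · -- `b1Var true = β₁ τ̃`, and the pivotal line is long
    calc b1Var d b true p q = wβ₁ b * tauTildePcE d (q.2 - p.2) := by
          simp only [b1Var, wβc, b1Er, kProp, oneF_apply, if_true]; ring
      _ ≤ wβ₁ b * wβ₂ d b := mul_le_mul' le_rfl (tauTildePcE_le_wβ₂_of_far hb h)
      _ = b1Both d b p q := by simp [b1Both, kProp]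
  · calc b1Var d b false p q = wβ₂ d b * tauPcE d (q.1 - p.1) := by
          simp only [b1Var, wβc, b1Er, kProp, oneF_apply, Bool.false_eq_true, if_false, mul_one]
      _ ≤ wβ₂ d b * wβ₁ b := mul_le_mul' le_rfl (tauPcE_le_wβ₁_of_far hb h)
      _ = b1Both d b p q := by simp [b1Both, kProp, mul_comm]

/-- **A long line of `B₂` of the strand entering on coordinate `c`**: `B₂ ≤ Σ` (its variants).
On coordinate 1 the line `u → t` is a factor of both terms; on coordinate 2 the line `v → s` is a
factor of `B₂⁽¹⁾`, while `B₂⁽²⁾` forces `v = s`, impossible for a long displacement (`x ≠ 0`).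
[cite: HeydenreichVanDerHofstad2017, (7.4.4) and §7.5.2 ("the displacement … vanishes")] -/
theorem kB2_le_b2Vars (hx : x ≠ 0) (c : Bool) {p q : Site d × Site d}
    (h : euclidNorm x / (2 * (n : ℝ) + 3) ≤ euclidNorm (crd (!c) q - crd c p)) :
    kB2 d p q ≤ lksum (b2Vars d b c) p q := by
  cases c
  · -- entering on coordinate 2: the line `v → s = q.1 - p.2` is long
    simp only [Bool.not_false, crd_true, crd_false] at h
    have hne : p.2 ≠ q.1 := by
      intro heq
      rw [heq, sub_self, euclidNorm_zero'] at h
      exact absurd h (not_le.2 (scale_pos hx n))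
    simp only [b2Vars, lksum_cons, lksum_nil, add_zero, Bool.false_eq_true, if_false]
    rw [kB2_apply]
    have h2 : kB2two d p q = 0 := by simp [kB2two, percB2two, hne]
    rw [h2, add_zero]
    calc kB2one d p q = tauPcE d (p.2 - p.1) * tauPcE d (q.2 - p.1) * tauPcE d (q.1 - p.2) * tauPcE d (q.2 - q.1) := rfl
      _ ≤ tauPcE d (p.2 - p.1) * tauPcE d (q.2 - p.1) * wβ₁ b * tauPcE d (q.2 - q.1) :=
          mul_le_mul' (mul_le_mul' le_rfl (tauPcE_le_wβ₁_of_far hb h)) le_rfl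
      _ = b2Var d b false p q := by
          simp only [b2Var, b2oneCore, kRungL, kRungR, kPropX, oneF_apply]; ring
  · -- entering on coordinate 1: the line `u → t = q.2 - p.1` is long
    simp only [Bool.not_true, crd_true, crd_false] at h
    simp only [b2Vars, lksum_cons, lksum_nil, add_zero, if_true]
    rw [kB2_apply]
    refine add_le_add ?_ ?_
    · calc kB2one d p q = tauPcE d (p.2 - p.1) * tauPcE d (q.2 - p.1) * tauPcE d (q.1 - p.2) * tauPcE d (q.2 - q.1) := rfl
        _ ≤ tauPcE d (p.2 - p.1) * wβ₁ b * tauPcE d (q.1 - p.2) * tauPcE d (q.2 - q.1) :=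
            mul_le_mul' (mul_le_mul' (mul_le_mul' le_rfl (tauPcE_le_wβ₁_of_far hb h)) le_rfl) le_rfl
        _ = b2Var d b true p q := by
            simp only [b2Var, b2oneCore, kRungL, kRungR, kPropX, oneF_apply]; ring
    · rw [kB2two_eq_kB2twoEr_mul]
      calc kB2twoEr d p q * tauPcE d (q.2 - p.1) ≤ kB2twoEr d p q * wβ₁ b := mul_le_mul' le_rfl (tauPcE_le_wβ₁_of_far hb h)
        _ = stVar d b p q := by rw [stVar, mul_comm]

/-- A long line of `B₂` on the strand entering on `c` upgrades the variants of the other strand to the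
doubly erased `B₂⁽¹⁾` (the star variant vanishes: its `δ` is incompatible with a long `v → s`). [cite: Hara2008, §3.5] -/
theorem b2Vars_not_le_b2Both (hx : x ≠ 0) (c : Bool) {p q : Site d × Site d}
    (h : euclidNorm x / (2 * (n : ℝ) + 3) ≤ euclidNorm (crd (!c) q - crd c p)) :
    lksum (b2Vars d b (!c)) p q ≤ lksum [b2Both d b] p q := by
  cases c
  · -- other strand enters on coordinate 1: variants `[b2Var true, stVar]`; long line `q.1 - p.2`
    simp only [Bool.not_false, crd_true, crd_false] at h
    have hne : p.2 ≠ q.1 := by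
      intro heq
      rw [heq, sub_self, euclidNorm_zero'] at h
      exact absurd h (not_le.2 (scale_pos hx n))
    simp only [Bool.not_false, b2Vars, if_true, lksum_cons, lksum_nil, add_zero]
    have h2 : stVar d b p q = 0 := by simp [stVar, kB2twoEr, hne]
    rw [h2, add_zero]
    calc b2Var d b true p q = wβ₁ b * (tauPcE d (p.2 - p.1) * tauPcE d (q.1 - p.2) * tauPcE d (q.2 - q.1)) := by
          simp only [b2Var, b2oneCore, kRungL, kRungR, kPropX, oneF_apply]; ring
      _ ≤ wβ₁ b * (tauPcE d (p.2 - p.1) * wβ₁ b * tauPcE d (q.2 - q.1)) :=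
          mul_le_mul' le_rfl (mul_le_mul' (mul_le_mul' le_rfl (tauPcE_le_wβ₁_of_far hb h)) le_rfl)
      _ = b2Both d b p q := by simp only [b2Both, kRungL, kRungR, kPropX, oneF_apply]; ring
  · simp only [Bool.not_true, crd_true, crd_false] at h
    simp only [Bool.not_true, b2Vars, Bool.false_eq_true, if_false, lksum_cons, lksum_nil, add_zero]
    calc b2Var d b false p q = wβ₁ b * (tauPcE d (p.2 - p.1) * tauPcE d (q.2 - p.1) * tauPcE d (q.2 - q.1)) := by
          simp only [b2Var, b2oneCore, kRungL, kRungR, kPropX, oneF_apply]; ring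
      _ ≤ wβ₁ b * (tauPcE d (p.2 - p.1) * wβ₁ b * tauPcE d (q.2 - q.1)) :=
          mul_le_mul' le_rfl (mul_le_mul' (mul_le_mul' le_rfl (tauPcE_le_wβ₁_of_far hb h)) le_rfl)
      _ = b2Both d b p q := by simp only [b2Both, kRungL, kRungR, kPropX, oneF_apply]; ring

/-- **Validity of the fine stage `j`** relative to the readers `crd (cAt j)`, `crd (!cAt j)` of its
input pair. [cite: Hara2008, §3.5 (picking long segments)] -/
theorem stageAt_valid (hx : x ≠ 0) (j : ℕ) :
    (stageAt d b j).Valid euclidNorm (euclidNorm x / (2 * (n : ℝ) + 3)) (crd (cAt j)) (crd (!cAt j)) := by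
  rcases Nat.even_or_odd' j with ⟨i, rfl | rfl⟩
  · -- a `B₁` stage: readers unchanged
    have hK : (stageAt d b (2 * i)).K = kB1 d := by simp [stageAt_K]
    have hφ₁ : (stageAt d b (2 * i)).φ₁ = crd (cAt (2 * i)) := by
      show crd (cAt (2 * i + 1)) = _; rw [cAt_succ_two_mul]
    have hφ₂ : (stageAt d b (2 * i)).φ₂ = crd (!cAt (2 * i)) := by
      show crd (!cAt (2 * i + 1)) = _; rw [cAt_succ_two_mul]
    have hK1 : (stageAt d b (2 * i)).K1 = [b1Var d b (cAt (2 * i))] := by simp [stageAt, varsAt]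
    have hK2 : (stageAt d b (2 * i)).K2 = [b1Var d b (!cAt (2 * i))] := by simp [stageAt, varsAt]
    have hK12 : (stageAt d b (2 * i)).K12 = [b1Both d b] := by simp [stageAt, bothAt]
    refine ⟨fun p q h => ?_, fun p q h => ?_, fun p q h => ?_, fun p q h => ?_⟩ <;>
      simp only [hK, hφ₁, hφ₂, hK1, hK2, hK12, stageAt_c₁, stageAt_c₂, Nat.cast_one, one_mul, lksum_cons,
        lksum_nil, add_zero] at h ⊢
    · exact kB1_le_b1Var hb _ h
    · exact kB1_le_b1Var hb _ h
    · exact b1Var_not_le_b1Both hb _ h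
    · simpa using b1Var_not_le_b1Both hb (!cAt (2 * i)) h
  · -- a `B₂` stage: readers interchanged
    have hK : (stageAt d b (2 * i + 1)).K = kB2 d := by simp [stageAt_K]
    have hφ₁ : (stageAt d b (2 * i + 1)).φ₁ = crd (!cAt (2 * i + 1)) := by
      show crd (cAt (2 * i + 1 + 1)) = _; rw [cAt_succ_two_mul_add_one]
    have hφ₂ : (stageAt d b (2 * i + 1)).φ₂ = crd (cAt (2 * i + 1)) := by
      show crd (!cAt (2 * i + 1 + 1)) = _; rw [cAt_succ_two_mul_add_one, Bool.not_not]
    have hK1 : (stageAt d b (2 * i + 1)).K1 = b2Vars d b (cAt (2 * i + 1)) := by simp [stageAt, varsAt]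
    have hK2 : (stageAt d b (2 * i + 1)).K2 = b2Vars d b (!cAt (2 * i + 1)) := by simp [stageAt, varsAt]
    have hK12 : (stageAt d b (2 * i + 1)).K12 = [b2Both d b] := by simp [stageAt, bothAt]
    refine ⟨fun p q h => ?_, fun p q h => ?_, fun p q h => ?_, fun p q h => ?_⟩ <;>
      simp only [hK, hφ₁, hφ₂, hK1, hK2, hK12, stageAt_c₁, stageAt_c₂, Nat.cast_one, one_mul] at h ⊢
    · exact kB2_le_b2Vars hb hx _ h
    · exact kB2_le_b2Vars hb hx (!cAt (2 * i + 1)) (by simpa using h)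
    · exact b2Vars_not_le_b2Both hb hx _ h
    · simpa using b2Vars_not_le_b2Both hb hx (!cAt (2 * i + 1)) (by simpa using h)

/-- **Validity of all stages** from `k` on, relative to the readers at `k`. [cite: Hara2008, §3.5] -/
theorem stagesFrom_valid (hx : x ≠ 0) (k m : ℕ) :
    StagesValid euclidNorm (euclidNorm x / (2 * (n : ℝ) + 3)) (crd (cAt k)) (crd (!cAt k)) (stagesFrom d b k m) := by
  induction m generalizing k with
  | zero => trivial
  | succ m ih =>
    rw [stagesFrom_succ]
    exact ⟨stageAt_valid hb hx k, ih (k + 1)⟩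

/-- Validity of the whole stage list relative to the start readers `fst`, `snd`. [cite: Hara2008, §3.5] -/
theorem stagesL_valid (hx : x ≠ 0) :
    StagesValid euclidNorm (euclidNorm x / (2 * (n : ℝ) + 3)) (crd true) (crd false) (stagesL d b n) :=
  stagesFrom_valid hb hx 0 (2 * n + 1)

/-- **The start accumulators** `Ψ^{(0)}`, `β₁·`(start with line 1 erased), `β₁·`(line 2 erased),
`β₁²ρ` are valid with counts `(1,1)` at `x₀ = 0`. [cite: Hara2008, §3.5] -/
theorem start_inv :
    (⟨kPsiZero d, fun P => wβ₁ b * stEr d true (0, 0) P, fun P => wβ₁ b * stEr d false (0, 0) P,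
      fun P => wβ₁ b ^ 2 * rho d P⟩ : MState (Site d)).Inv euclidNorm (euclidNorm x / (2 * (n : ℝ) + 3)) 0
      (crd true) (crd false) 1 1 := by
  have hΨ : ∀ P : Site d × Site d, kPsiZero d P = tauPcE d (P.1 - 0) * tauPcE d (P.2 - 0) * tauPcE d (P.2 - P.1) := by
    intro P
    rw [kPsiZero_eq_kStartW, kStartW, kRungR, kProp, gE_zero_exp, gE_zero_exp]
  have h1 : ∀ P : Site d × Site d, stEr d true (0, 0) P = tauPcE d (P.2 - 0) * tauPcE d (P.2 - P.1) := by
    intro P; simp [stEr, kRungR, kProp]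
  have h2 : ∀ P : Site d × Site d, stEr d false (0, 0) P = tauPcE d (P.1 - 0) * tauPcE d (P.2 - P.1) := by
    intro P; simp [stEr, kRungR, kProp]
  refine MState.inv_start (fun P h => ?_) (fun P h => ?_) (fun P h => ?_) (fun P h => ?_) <;>
    simp only [Nat.cast_one, one_mul, crd_true, crd_false] at h ⊢
  · rw [hΨ, h1]
    calc tauPcE d (P.1 - 0) * tauPcE d (P.2 - 0) * tauPcE d (P.2 - P.1)
        ≤ wβ₁ b * tauPcE d (P.2 - 0) * tauPcE d (P.2 - P.1) :=
          mul_le_mul' (mul_le_mul' (tauPcE_le_wβ₁_of_far hb h) le_rfl) le_rfl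
      _ = _ := by ring
  · rw [hΨ, h2]
    calc tauPcE d (P.1 - 0) * tauPcE d (P.2 - 0) * tauPcE d (P.2 - P.1)
        ≤ tauPcE d (P.1 - 0) * wβ₁ b * tauPcE d (P.2 - P.1) :=
          mul_le_mul' (mul_le_mul' le_rfl (tauPcE_le_wβ₁_of_far hb h)) le_rfl
      _ = _ := by ring
  · rw [h2, rho_apply]
    calc wβ₁ b * (tauPcE d (P.1 - 0) * tauPcE d (P.2 - P.1)) ≤ wβ₁ b * (wβ₁ b * tauPcE d (P.2 - P.1)) :=
          mul_le_mul' le_rfl (mul_le_mul' (tauPcE_le_wβ₁_of_far hb h) le_rfl)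
      _ = _ := by ring
  · rw [h1, rho_apply]
    calc wβ₁ b * (tauPcE d (P.2 - 0) * tauPcE d (P.2 - P.1)) ≤ wβ₁ b * (wβ₁ b * tauPcE d (P.2 - P.1)) :=
          mul_le_mul' le_rfl (mul_le_mul' (tauPcE_le_wβ₁_of_far hb h) le_rfl)
      _ = _ := by ring

omit hb in
/-- The end vector and its erased versions. [cite: HeydenreichVanDerHofstad2017, (7.4.10)] -/
theorem kA3end_eq' (Q : Site d × Site d) :
    kA3end d Q x = tauPcE d (Q.2 - Q.1) * (tauPcE d (x - Q.1) * tauPcE d (x - Q.2)) := by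
  rw [kA3end_eq_kEndW, kEndW, kRungL, kProp, gE_zero_exp, gE_zero_exp]

omit hb in
/-- `enEr true Q (x,x) = ρ(Q) τ(x - Q.2)`. [folklore] -/
theorem enEr_true_apply (Q : Site d × Site d) : enEr d true Q (x, x) = tauPcE d (Q.2 - Q.1) * tauPcE d (x - Q.2) := by
  simp [enEr, kRungL, kProp]

omit hb in
/-- `enEr false Q (x,x) = ρ(Q) τ(x - Q.1)`. [folklore] -/
theorem enEr_false_apply (Q : Site d × Site d) : enEr d false Q (x, x) = tauPcE d (Q.2 - Q.1) * tauPcE d (x - Q.1) := by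
  simp [enEr, kRungL, kProp]

/-- **A long end line from coordinate `c`**: `A₃(Q, x) ≤ β₁ ·` (end with that line erased).
[cite: Hara2008, §3.5 ("two factors of G_{x,N}")] -/
theorem kA3end_le_enEr (c : Bool) {Q : Site d × Site d}
    (h : euclidNorm x / (2 * (n : ℝ) + 3) ≤ euclidNorm (x - crd c Q)) : kA3end d Q x ≤ wβ₁ b * enEr d c Q (x, x) := by
  cases c
  · rw [kA3end_eq', enEr_false_apply]
    simp only [crd_false] at h
    calc tauPcE d (Q.2 - Q.1) * (tauPcE d (x - Q.1) * tauPcE d (x - Q.2))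
        ≤ tauPcE d (Q.2 - Q.1) * (tauPcE d (x - Q.1) * wβ₁ b) := mul_le_mul' le_rfl (mul_le_mul' le_rfl (tauPcE_le_wβ₁_of_far hb h))
      _ = _ := by ring
  · rw [kA3end_eq', enEr_true_apply]
    simp only [crd_true] at h
    calc tauPcE d (Q.2 - Q.1) * (tauPcE d (x - Q.1) * tauPcE d (x - Q.2))
        ≤ tauPcE d (Q.2 - Q.1) * (wβ₁ b * tauPcE d (x - Q.2)) := mul_le_mul' le_rfl (mul_le_mul' (tauPcE_le_wβ₁_of_far hb h) le_rfl)
      _ = _ := by ring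

/-- A long end line from coordinate `!c` upgrades the end erased on `c` to `β₁² ρ`. [cite: Hara2008, §3.5] -/
theorem enEr_le_rho (c : Bool) {Q : Site d × Site d}
    (h : euclidNorm x / (2 * (n : ℝ) + 3) ≤ euclidNorm (x - crd (!c) Q)) :
    wβ₁ b * enEr d c Q (x, x) ≤ wβ₁ b ^ 2 * rho d Q := by
  cases c
  · rw [enEr_false_apply, rho_apply]
    simp only [Bool.not_false, crd_true] at h
    calc wβ₁ b * (tauPcE d (Q.2 - Q.1) * tauPcE d (x - Q.1)) ≤ wβ₁ b * (tauPcE d (Q.2 - Q.1) * wβ₁ b) :=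
          mul_le_mul' le_rfl (mul_le_mul' le_rfl (tauPcE_le_wβ₁_of_far hb h))
      _ = _ := by ring
  · rw [enEr_true_apply, rho_apply]
    simp only [Bool.not_true, crd_false] at h
    calc wβ₁ b * (tauPcE d (Q.2 - Q.1) * tauPcE d (x - Q.2)) ≤ wβ₁ b * (tauPcE d (Q.2 - Q.1) * wβ₁ b) :=
          mul_le_mul' le_rfl (mul_le_mul' le_rfl (tauPcE_le_wβ₁_of_far hb h))
      _ = _ := by ring

end Valid

/-! ### The fine list with one or two kernels replaced -/

section Lists

variable {β : Type*}

/-- Replacing the element right after a prefix. [folklore] -/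
theorem list_set_append_length_cons (L₁ : List β) (a : β) (L₂ : List β) (M : β) :
    (L₁ ++ a :: L₂).set L₁.length M = L₁ ++ M :: L₂ := by
  induction L₁ with
  | nil => rfl
  | cons c L₁ ih => simp [ih]

/-- Replacing an element beyond a prefix. [folklore] -/
theorem list_set_append_length_add (L₁ L₂ : List β) (k : ℕ) (M : β) :
    (L₁ ++ L₂).set (L₁.length + k) M = L₁ ++ L₂.set k M := by
  induction L₁ with
  | nil => simp
  | cons c L₁ ih => simp [Nat.succ_add, ih]

/-- Replacing the element right after a prefix of known length. [folklore] -/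
theorem list_set_append_cons_of_length {L₁ : List β} {j : ℕ} (h : L₁.length = j) (a : β) (L₂ : List β) (M : β) :
    (L₁ ++ a :: L₂).set j M = L₁ ++ M :: L₂ := by
  subst h; exact list_set_append_length_cons L₁ a L₂ M

/-- Replacing an element beyond a prefix of known length. [folklore] -/
theorem list_set_append_add_of_length {L₁ : List β} {j : ℕ} (h : L₁.length = j) (L₂ : List β) (k : ℕ) (M : β) :
    (L₁ ++ L₂).set (j + k) M = L₁ ++ L₂.set k M := by
  subst h; exact list_set_append_length_add L₁ L₂ k M

/-- **Two replacements in an alternating list**: positions `a` and `a + 1 + k` of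
`altL c (a + 1 + k + 1 + t)`. [folklore] -/
theorem altL_set_set (c : Bool) (a k t : ℕ) (M M' : Site d × Site d → Site d × Site d → ℝ≥0∞) :
    ((altL d c (a + 1 + k + 1 + t)).set a M).set (a + 1 + k) M' =
      altL d c a ++ M :: (altL d (xor c (Nat.bodd (a + 1))) k ++ M' :: altL d (xor c (Nat.bodd (a + k))) t) := by
  have hsplit : altL d c (a + 1 + k + 1 + t) = altL d c a ++ (if xor c (Nat.bodd a) then kB1 d else kB2 d) ::
      (altL d (xor c (Nat.bodd (a + 1))) k ++ (if xor c (Nat.bodd (a + 1 + k)) then kB1 d else kB2 d) ::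
        altL d (xor c (Nat.bodd (a + k))) t) := by
    rw [show a + 1 + k + 1 + t = a + (k + t + 1 + 1) by ring, altL_add, altL_succ,
      show k + t + 1 = k + (t + 1) by ring, altL_add, altL_succ]
    have e1 : (!xor c (Nat.bodd a)) = xor c (Nat.bodd (a + 1)) := by
      rw [Nat.bodd_succ]; cases c <;> cases Nat.bodd a <;> rfl
    have e2 : xor (xor c (Nat.bodd (a + 1))) (Nat.bodd k) = xor c (Nat.bodd (a + 1 + k)) := by
      rw [Nat.bodd_add (a + 1) k]; cases c <;> cases Nat.bodd (a + 1) <;> cases Nat.bodd k <;> rfl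
    have e3 : (!xor c (Nat.bodd (a + 1 + k))) = xor c (Nat.bodd (a + k)) := by
      rw [show a + 1 + k = (a + k) + 1 by ring, Nat.bodd_succ]; cases c <;> cases Nat.bodd (a + k) <;> rfl
    rw [e1, e2, e3]
  have hlen : (altL d c a ++ [M]).length = a + 1 := by simp
  rw [hsplit, list_set_append_cons_of_length (length_altL c a), ← List.singleton_append, ← List.append_assoc,
    list_set_append_add_of_length hlen, list_set_append_cons_of_length (length_altL _ k), List.append_assoc,
    List.singleton_append]

/-- **One replacement in an alternating list**: position `a` of `altL c (a + 1 + t)`. [folklore] -/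
theorem altL_set_one (c : Bool) (a t : ℕ) (M : Site d × Site d → Site d × Site d → ℝ≥0∞) :
    (altL d c (a + 1 + t)).set a M = altL d c a ++ M :: altL d (xor c (Nat.bodd (a + 1))) t := by
  have hsplit : altL d c (a + 1 + t) = altL d c a ++ (if xor c (Nat.bodd a) then kB1 d else kB2 d) ::
      altL d (xor c (Nat.bodd (a + 1))) t := by
    rw [show a + 1 + t = a + (t + 1) by ring, altL_add, altL_succ]
    have e1 : (!xor c (Nat.bodd a)) = xor c (Nat.bodd (a + 1)) := by
      rw [Nat.bodd_succ]; cases c <;> cases Nat.bodd a <;> rfl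
    rw [e1]
  rw [hsplit, list_set_append_cons_of_length (length_altL c a)]

/-- Marks at `B₁(2i)` and `B₁(2(i+k+1))`, `n = i + k + 1 + t`. [folklore] -/
theorem altL_set_ee (i k t : ℕ) (M M' : Site d × Site d → Site d × Site d → ℝ≥0∞) :
    ((altL d true (2 * (i + k + 1 + t) + 1)).set (2 * i) M).set (2 * i + 2 * k + 2) M' =
      altL d true (2 * i) ++ M :: (altL d false (2 * k + 1) ++ M' :: altL d false (2 * t)) := by
  have h := altL_set_set (d := d) true (2 * i) (2 * k + 1) (2 * t) M M'
  have hb1 : Nat.bodd (2 * i + 1) = true := bodd_two_mul_add_one i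
  have hb2 : Nat.bodd (2 * i + (2 * k + 1)) = true := by rw [show 2 * i + (2 * k + 1) = 2 * (i + k) + 1 by ring, bodd_two_mul_add_one]
  rw [hb1, hb2, show 2 * i + 1 + (2 * k + 1) + 1 + 2 * t = 2 * (i + k + 1 + t) + 1 by ring,
    show 2 * i + 1 + (2 * k + 1) = 2 * i + 2 * k + 2 by ring] at h
  simpa only [Bool.true_xor, Bool.not_true, Bool.not_false] using h

/-- Marks at `B₁(2i)` and `B₂(2(i+k)+1)`, `n = i + k + t + 1`. [folklore] -/
theorem altL_set_eo (i k t : ℕ) (M M' : Site d × Site d → Site d × Site d → ℝ≥0∞) :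
    ((altL d true (2 * (i + k + t + 1) + 1)).set (2 * i) M).set (2 * i + 2 * k + 1) M' =
      altL d true (2 * i) ++ M :: (altL d false (2 * k) ++ M' :: altL d true (2 * t + 1)) := by
  have h := altL_set_set (d := d) true (2 * i) (2 * k) (2 * t + 1) M M'
  have hb1 : Nat.bodd (2 * i + 1) = true := bodd_two_mul_add_one i
  have hb2 : Nat.bodd (2 * i + 2 * k) = false := by rw [show 2 * i + 2 * k = 2 * (i + k) by ring, bodd_two_mul]
  rw [hb1, hb2, show 2 * i + 1 + 2 * k + 1 + (2 * t + 1) = 2 * (i + k + t + 1) + 1 by ring,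
    show 2 * i + 1 + 2 * k = 2 * i + 2 * k + 1 by ring] at h
  simpa only [Bool.true_xor, Bool.not_true, Bool.not_false] using h

/-- Marks at `B₂(2i+1)` and `B₁(2(i+k+1))`, `n = i + k + 1 + t`. [folklore] -/
theorem altL_set_oe (i k t : ℕ) (M M' : Site d × Site d → Site d × Site d → ℝ≥0∞) :
    ((altL d true (2 * (i + k + 1 + t) + 1)).set (2 * i + 1) M).set (2 * i + 2 * k + 2) M' =
      altL d true (2 * i + 1) ++ M :: (altL d true (2 * k) ++ M' :: altL d false (2 * t)) := by
  have h := altL_set_set (d := d) true (2 * i + 1) (2 * k) (2 * t) M M'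
  have hb1 : Nat.bodd (2 * i + 1 + 1) = false := by rw [show 2 * i + 1 + 1 = 2 * (i + 1) by ring, bodd_two_mul]
  have hb2 : Nat.bodd (2 * i + 1 + 2 * k) = true := by rw [show 2 * i + 1 + 2 * k = 2 * (i + k) + 1 by ring, bodd_two_mul_add_one]
  rw [hb1, hb2, show 2 * i + 1 + 1 + 2 * k + 1 + 2 * t = 2 * (i + k + 1 + t) + 1 by ring,
    show 2 * i + 1 + 1 + 2 * k = 2 * i + 2 * k + 2 by ring] at h
  simpa only [Bool.true_xor, Bool.not_true, Bool.not_false] using h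

/-- Marks at `B₂(2i+1)` and `B₂(2(i+k+1)+1)`, `n = i + k + t + 2`. [folklore] -/
theorem altL_set_oo (i k t : ℕ) (M M' : Site d × Site d → Site d × Site d → ℝ≥0∞) :
    ((altL d true (2 * (i + k + t + 2) + 1)).set (2 * i + 1) M).set (2 * i + 2 * k + 3) M' =
      altL d true (2 * i + 1) ++ M :: (altL d true (2 * k + 1) ++ M' :: altL d true (2 * t + 1)) := by
  have h := altL_set_set (d := d) true (2 * i + 1) (2 * k + 1) (2 * t + 1) M M'
  have hb1 : Nat.bodd (2 * i + 1 + 1) = false := by rw [show 2 * i + 1 + 1 = 2 * (i + 1) by ring, bodd_two_mul]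
  have hb2 : Nat.bodd (2 * i + 1 + (2 * k + 1)) = false := by
    rw [show 2 * i + 1 + (2 * k + 1) = 2 * (i + k + 1) by ring, bodd_two_mul]
  rw [hb1, hb2, show 2 * i + 1 + 1 + (2 * k + 1) + 1 + (2 * t + 1) = 2 * (i + k + t + 2) + 1 by ring,
    show 2 * i + 1 + 1 + (2 * k + 1) = 2 * i + 2 * k + 3 by ring] at h
  simpa only [Bool.true_xor, Bool.not_true, Bool.not_false] using h

/-- One mark at `B₁(2i)`, `n = i + t`. [folklore] -/
theorem altL_set_e (i t : ℕ) (M : Site d × Site d → Site d × Site d → ℝ≥0∞) :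
    (altL d true (2 * (i + t) + 1)).set (2 * i) M = altL d true (2 * i) ++ M :: altL d false (2 * t) := by
  have h := altL_set_one (d := d) true (2 * i) (2 * t) M
  have hb1 : Nat.bodd (2 * i + 1) = true := bodd_two_mul_add_one i
  rw [hb1, show 2 * i + 1 + 2 * t = 2 * (i + t) + 1 by ring] at h
  simpa only [Bool.true_xor, Bool.not_true, Bool.not_false] using h

/-- One mark at `B₂(2i+1)`, `n = i + t + 1`. [folklore] -/
theorem altL_set_o (i t : ℕ) (M : Site d × Site d → Site d × Site d → ℝ≥0∞) :
    (altL d true (2 * (i + t + 1) + 1)).set (2 * i + 1) M = altL d true (2 * i + 1) ++ M :: altL d true (2 * t + 1) := by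
  have h := altL_set_one (d := d) true (2 * i + 1) (2 * t + 1) M
  have hb1 : Nat.bodd (2 * i + 1 + 1) = false := by rw [show 2 * i + 1 + 1 = 2 * (i + 1) by ring, bodd_two_mul]
  rw [hb1, show 2 * i + 1 + 1 + (2 * t + 1) = 2 * (i + t + 1) + 1 by ring] at h
  simpa only [Bool.true_xor, Bool.not_true, Bool.not_false] using h

end Lists

end Literature.Barriers.CriticalPhenomena
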